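import Summits.HubbardSuperconductivity.HubbardSuperconductivity.Theorems.AnisotropyChordTransferFibre3ShellReduction
import Summits.HubbardSuperconductivity.HubbardSuperconductivity.Theorems.AnisotropyChordTransferFibre3ShellBulk
import Summits.HubbardSuperconductivity.HubbardSuperconductivity.Theorems.AnisotropyChordTransferFibre3NC0Split
import Summits.HubbardSuperconductivity.HubbardSuperconductivity.Theorems.AnisotropyChordTransferFibre3C0FreeBound

/-!
# Route `AnisotropyChord` / H0 rotor rung: PartN41-C §4 — the ROW ASSEMBLY `NC0Row` PROVED (`L ≥ 3`)

Theory-1 g22's PartN41-C §4 `NC0Row` (port …Fibre3KT2bRow): the `Nhi` bracket of the KT-2b row,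
`‖C0′‖² ≤ (9/4)M²Ψ + 12·(Σ_{b ∈ shellWin} C0(x̂,b)² + (17 f_nn²δ² + 8ξ²M² + 16ζ²M²)·τ̄)`,
assembled from `‖C0′‖² ≤ ‖C0‖² = ‖C0‖²_{W=0} + Sh` (`ShellRow.nC0p_le_nC0`, `ShellRow.nC0_split`), route R1
`‖C0‖²_{W=0} ≤ (9/4)M²Ψ` (`c0FreeBound_holds`), the shell reduction `Sh ≤ 12·Σ_{b ∉ {0,x̂}} C0(x̂,b)²`
(`ShellRow.shell_reduction`) and the crude bulk bound off the window (`ShellRow.shell_bulk_bound`):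
★ `ShellRow.nC0_row` and ★ `nC0Row_holds (hL : 3 ≤ L) (Δ) : NC0Row L Δ`.  With this file PartN41-C §4 is complete
(`NC0Split`, `C0PermInvariant`, `ShellReduction`, `C0ShellForm`, `ShellBulkBound`, `NC0Row` all proved; `KernelSubadditive`,
`LamIncrementBound`, `GradSupBound` of §4 are the L-uniform constants feeding `δ`, not used by the assembly itself).
Prover seat `hubbard-h0-rotor-p1` g27 (route lead); helper for stmt-HubbardSuperconductivity-23918 (`--supports`, helper class).
WHAT THIS IS NOT: nothing here proves superconductivity in the Hubbard model; the assembly of ONE bracket of ONE row of ONE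
conditional reduction.  Tree imports only; no new definitions; no sorry, no axioms.
-/

set_option linter.dupNamespace false
set_option autoImplicit false

noncomputable section

open scoped BigOperators

namespace Summit.HubbardSuperconductivity.HubbardSuperconductivity.Theorems.AnisotropyChord.Transfer.Fibre3

variable (L : ℕ) [NeZero L]

namespace ShellRow

/-- splitting the `x̂` row at the window: `Σ_{b ∉ {0,x̂}} ≤ Σ_{shellWin} + Σ_{bulk}` (nonnegative terms). [folklore] -/
theorem rowSum_split (Δ lam2 : ℝ) (f : Tor L → ℝ) :
    ∑ b ∈ ((Finset.univ : Finset (Tor L)).erase 0).erase (ex L), C0fn L Δ lam2 f (ex L, b) ^ 2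
      ≤ (∑ b ∈ shellWin L, C0fn L Δ lam2 f (ex L, b) ^ 2)
        + ∑ b ∈ (((Finset.univ : Finset (Tor L)).erase 0).erase (ex L)) \ shellWin L, C0fn L Δ lam2 f (ex L, b) ^ 2 := by
  classical
  rw [← Finset.sum_inter_add_sum_sdiff (((Finset.univ : Finset (Tor L)).erase 0).erase (ex L)) (shellWin L)]
  have h : ∑ b ∈ (((Finset.univ : Finset (Tor L)).erase 0).erase (ex L)) ∩ shellWin L, C0fn L Δ lam2 f (ex L, b) ^ 2
      ≤ ∑ b ∈ shellWin L, C0fn L Δ lam2 f (ex L, b) ^ 2 :=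
    Finset.sum_le_sum_of_subset_of_nonneg Finset.inter_subset_right fun b _ _ => sq_nonneg _
  linarith

/-- ★ the `Nhi` row assembly (body of `NC0Row L Δ`, `L ≥ 3`). [folklore] -/
theorem nC0_row (hL : 3 ≤ L) {Δ lam2 M δ : ℝ} {f : Tor L → ℝ} (hf : IsGroundTwoMagnon L Δ lam2 f)
    (hsw : ∀ r : Tor L, f (r.2, r.1) = f r) (hmi : ∀ r : Tor L, f (-r.1, r.2) = f r)
    (hM : ∀ r : Tor L, |f r| ≤ M)
    (hδ : ∀ e ∈ nnList L, ∀ b : Tor L, b ≠ 0 → b - e ≠ 0 → |Dgrad L f e b| ≤ δ) :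
    nC0p L Δ f ≤ 9 / 4 * M ^ 2 * PsiSum L Δ f
      + 12 * ((∑ b ∈ shellWin L, C0fn L Δ lam2 f (ex L, b) ^ 2)
        + (17 * f (ex L) ^ 2 * δ ^ 2 + 8 * xiW L f ^ 2 * M ^ 2 + 16 * zetaW L f ^ 2 * M ^ 2) * gradNormSq L Δ f) := by
  have heven := hf.2.1
  have h1 := nC0p_le_nC0 L hf.1
  have h2 := nC0_split L Δ lam2 f
  have h3 := c0FreeBound_holds L Δ lam2 M f hf.1 heven hM
  have h4 := shell_reduction L Δ lam2 heven hsw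
  have h5 := rowSum_split L Δ lam2 f
  have h6 := shell_bulk_bound L hL hf.1 heven hsw hmi hM hδ
  have e : nC0shell L Δ lam2 f
      = ∑ c ∈ Finset.univ.filter (fun c : Cfg L => Wcount L c ≠ 0), C0fn L Δ lam2 f c ^ 2 := rfl
  rw [← e] at h2
  linarith

end ShellRow

/-- ★ **`NC0Row L Δ` holds for `L ≥ 3`.** [folklore] -/
theorem nC0Row_holds (hL : 3 ≤ L) (Δ : ℝ) : NC0Row L Δ :=
  fun _ _ _ _ hf hsw hmi hM hδ _ => ShellRow.nC0_row L hL hf hsw hmi hM hδ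

end Summit.HubbardSuperconductivity.HubbardSuperconductivity.Theorems.AnisotropyChord.Transfer.Fibre3

end
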